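import Literature.Probability.Percolation.FullPlaneCNLProofs
import HarnessLib

/-!
# Typed loop collections of site percolation in a domain, and the bridge to `d_CN ≤ ε`

Topic `Literature/Probability/Percolation` (two definitions with API, proofs; no named fact).
Glue between the two renderings of the Camia–Newman scaling limit in the tree:

* the **domain** form (`CLE6.lean`): the closed set `triLoopCollection D δ ω : LoopSpace ℂ` of
  the curve classes `siteLoopCurve δ γ` of all interface loops `γ` of the configuration `ω`
  restricted to the Jordan domain `D` (sites outside `D` closed), compared in the Hausdorff
  extended distance over the (oriented, based) distance of `CurveClass ℂ` — the topology of the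
  named fact `exists_isCNLFamily_tendsto` (Camia–Newman, CMP 268 (2006), Thm 5; MSRI Publ. 55
  (2008), Thms 2–3);
* the **typed full-plane** form (`FullPlaneCNL.lean`): DKKMO's configuration
  `siteLoopConfig δ ω : LoopConfig ℂ` of *unbased* loops sorted by type (type `1` = counter-
  clockwise = exterior boundary of an open cluster, arXiv:2012.11672v2 §1.2), compared through
  the printed relation `d_CN ≤ ε` (`LoopConfig.IsClose`), the language of the named fact
  `exists_isFullPlaneCNLLaw` (CMP 268 (2006), Thms 1 and 6).

Contents:

* `typedTriLoopCollection D δ ω i : LoopSpace ℂ` — the closed set of curve classes of the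
  interface loops **of type `i`** of the restricted configuration (same typing predicate as
  `siteLoopConfig`: `i = 1 ↔ 0 < shoelace`); `typedTriLoopCollection_le`,
  `sup_typedTriLoopCollection` (the two types exhaust `triLoopCollection`), locality
  (`typedTriLoopCollection_eq_of_inter_eq`, `typedTriLoopCollection_inter_triMeshVertices`),
  `measurable_typedTriLoopCollection` and `finite_range_typedTriLoopCollection` at fixed mesh
  `δ > 0` (it factors through the finitely many sub-configurations of the finite mesh of `D`,
  as `measurable_triLoopCollection_holds`);
* `loopConfigOfLoopSpaces L : LoopConfig ℂ` — the typed configuration of unbased loops of a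
  pair `L : Fin 2 → LoopSpace ℂ` of loop collections (non-loop members ignored);
  `mk_mem_loopConfigOfLoopSpaces`, `siteLoopConfig_subset_loopConfigOfLoopSpaces`;
* `udist_mk_mk_le_dist` — the unbased unoriented distance `d` of DKKMO eq. (1) is dominated by
  the distance of curve classes;
* **the bridge** `isClose_siteLoopConfig_of_hausdorffEDist_lt`: if for both types the typed
  collection of `ω` in `D` at mesh `δ` is at Hausdorff distance `< η ≤ ε` from `L i`, all of
  whose members are loops, then
  `d_CN(siteLoopConfig δ (ω ∩ triMeshVertices D δ), loopConfigOfLoopSpaces L) ≤ ε`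
  (every lattice loop of type `i` has an `η`-close member of `L i` and conversely,
  `Metric.exists_edist_lt_of_hausdorffEDist_lt`, the closure in the definition of the
  collections being invisible to the Hausdorff distance, `Metric.hausdorffEDist_closure_left`);
  with `isClose_siteLoopConfig_inter_iff` (`FullPlaneCNLProofs.lean`) the restriction to `D`
  is then dropped inside the window (`isClose_siteLoopConfig_of_edist_lt_of_ball_subset`);
  `isClose_siteLoopConfig_of_edist_lt` is the same with the `LoopSpace` extended distance.

## References

* F. Camia, C. M. Newman, Comm. Math. Phys. 268 (2006) 1–38, §2, §5.2, §6 [CamiaNewman2006].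
* H. Duminil-Copin, K. K. Kozlowski, D. Krachun, I. Manolescu, M. Oulamara, arXiv:2012.11672v2
  (2026), §1.2, eq. (1) [arXiv201211672v2].
* M. Aizenman, A. Burchard, Duke Math. J. 99 (1999), §2.1 [AizenmanBurchardDuke1999].
-/

noncomputable section

open Set MeasureTheory Metric
open scoped ENNReal

namespace Literature.Probability.Percolation

open LatticeModels RandomPlanarGeometry

/-! ### Typed loop collections in a domain -/

/-- **The loop collection of type `i`** of critical site percolation at mesh `δ` in the Jordan
domain `D` with closed boundary condition: the closure in `CurveClass ℂ` of the set of classes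
`siteLoopCurve δ γ` of the interface loops `γ` of the restricted configuration
`ω ∩ triMeshVertices D.carrier δ` whose type is `i` — type `1` iff counter-clockwise, i.e.
positive shoelace sum of the visited face centres, iff the loop is the exterior boundary of an
open cluster (DKKMO, arXiv:2012.11672v2, §1.2; the typing predicate of `siteLoopConfig`).
`triLoopCollection D δ ω` is the union of the two (`sup_typedTriLoopCollection`).
(Camia–Newman, CMP 268 (2006), §2 and §5.2: the lattice loops carry an orientation.) [cite: arXiv201211672v2, §1.2] -/
def typedTriLoopCollection (D : JordanDomain) (δ : ℝ) (ω : SiteConfig (Site 2)) (i : Fin 2) :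
    LoopSpace ℂ :=
  .closure {c | ∃ (f : HexVertex) (γ : hexGraph.Walk f f),
    IsSiteInterfaceLoop (ω ∩ triMeshVertices D.carrier δ) γ ∧
      (i = 1 ↔ 0 < shoelace (γ.support.map hexCenter)) ∧ c = siteLoopCurve δ γ}

/-- The underlying set of the typed collection is the closure of its generating set. [folklore] -/
theorem coe_typedTriLoopCollection (D : JordanDomain) (δ : ℝ) (ω : SiteConfig (Site 2)) (i : Fin 2) :
    (typedTriLoopCollection D δ ω i : Set (CurveClass ℂ)) =
      closure {c | ∃ (f : HexVertex) (γ : hexGraph.Walk f f),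
        IsSiteInterfaceLoop (ω ∩ triMeshVertices D.carrier δ) γ ∧
          (i = 1 ↔ 0 < shoelace (γ.support.map hexCenter)) ∧ c = siteLoopCurve δ γ} :=
  rfl

/-- The class of an interface loop of type `i` of the restricted configuration belongs to the
typed collection. [folklore] -/
theorem siteLoopCurve_mem_typedTriLoopCollection {D : JordanDomain} {δ : ℝ}
    {ω : SiteConfig (Site 2)} {i : Fin 2} {f : HexVertex} {γ : hexGraph.Walk f f}
    (hγ : IsSiteInterfaceLoop (ω ∩ triMeshVertices D.carrier δ) γ)
    (hi : i = 1 ↔ 0 < shoelace (γ.support.map hexCenter)) :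
    siteLoopCurve δ γ ∈ typedTriLoopCollection D δ ω i :=
  subset_closure ⟨f, γ, hγ, hi, rfl⟩

/-- Each typed collection is a sub-collection of the full loop collection. [folklore] -/
theorem typedTriLoopCollection_le (D : JordanDomain) (δ : ℝ) (ω : SiteConfig (Site 2))
    (i : Fin 2) : typedTriLoopCollection D δ ω i ≤ triLoopCollection D δ ω := by
  refine TopologicalSpace.Closeds.closure_le.2 ?_
  rintro c ⟨f, γ, hγ, -, rfl⟩
  exact siteLoopCurve_mem_triLoopCollection hγ

/-- **The two types exhaust the loop collection**: `triLoopCollection D δ ω` is the union of the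
collections of type `0` and of type `1`. [folklore] -/
theorem sup_typedTriLoopCollection (D : JordanDomain) (δ : ℝ) (ω : SiteConfig (Site 2)) :
    typedTriLoopCollection D δ ω 0 ⊔ typedTriLoopCollection D δ ω 1 = triLoopCollection D δ ω := by
  refine le_antisymm (sup_le (typedTriLoopCollection_le D δ ω 0) (typedTriLoopCollection_le D δ ω 1))
    (TopologicalSpace.Closeds.closure_le.2 ?_)
  rintro c ⟨f, γ, hγ, rfl⟩
  rw [TopologicalSpace.Closeds.coe_sup]
  by_cases h : 0 < shoelace (γ.support.map hexCenter)
  · exact Or.inr (siteLoopCurve_mem_typedTriLoopCollection hγ (iff_of_true rfl h))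
  · exact Or.inl (siteLoopCurve_mem_typedTriLoopCollection hγ
      (iff_of_false Fin.zero_ne_one h))

/-- Every member of a typed collection is a loop. [folklore] -/
theorem isLoop_of_mem_typedTriLoopCollection {D : JordanDomain} {δ : ℝ} {ω : SiteConfig (Site 2)}
    {i : Fin 2} {c : CurveClass ℂ} (hc : c ∈ typedTriLoopCollection D δ ω i) : c.IsLoop :=
  isLoop_of_mem_triLoopCollection (typedTriLoopCollection_le D δ ω i hc)

/-- Locality: the typed collections only depend on the trace of the configuration on the mesh
of `D`. [folklore] -/
theorem typedTriLoopCollection_eq_of_inter_eq {D : JordanDomain} {δ : ℝ}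
    {ω ω' : SiteConfig (Site 2)}
    (h : ω ∩ triMeshVertices D.carrier δ = ω' ∩ triMeshVertices D.carrier δ) :
    typedTriLoopCollection D δ ω = typedTriLoopCollection D δ ω' := by
  funext i
  unfold typedTriLoopCollection
  rw [h]

/-- Restricting the configuration to the mesh of `D` does not change the typed collections. [folklore] -/
theorem typedTriLoopCollection_inter_triMeshVertices (D : JordanDomain) (δ : ℝ)
    (ω : SiteConfig (Site 2)) :
    typedTriLoopCollection D δ (ω ∩ triMeshVertices D.carrier δ) = typedTriLoopCollection D δ ω :=
  typedTriLoopCollection_eq_of_inter_eq (by rw [inter_assoc, inter_self])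

/-- **At fixed mesh `δ > 0` the typed collections take finitely many values** (they factor
through the finitely many sub-configurations of the finite mesh of `D`,
`triMeshVertices_finite_holds`). [folklore] -/
theorem finite_range_typedTriLoopCollection (D : JordanDomain) {δ : ℝ} (hδ : 0 < δ) :
    (range (typedTriLoopCollection D δ)).Finite := by
  have hfin : {A : Set (Site 2) | A ⊆ triMeshVertices D.carrier δ}.Finite :=
    (triMeshVertices_finite_holds D.isBounded hδ).finite_subsets
  refine (hfin.image fun A ↦ typedTriLoopCollection D δ A).subset ?_
  rintro _ ⟨ω, rfl⟩
  exact ⟨ω ∩ triMeshVertices D.carrier δ, inter_subset_right,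
    typedTriLoopCollection_inter_triMeshVertices D δ ω⟩

/-- **At fixed mesh `δ > 0` the typed collections are measurable** in the configuration (jointly,
for the product σ-algebra on `Fin 2 → LoopSpace ℂ`): as `measurable_triLoopCollection_holds`,
the map factors through the trace on the finite mesh of `D`, a measurable map into a countable
type. (Camia–Newman 2006, §2.2.) [cite: CamiaNewman2006, §2.2] -/
theorem measurable_typedTriLoopCollection (D : JordanDomain) {δ : ℝ} (hδ : 0 < δ) :
    Measurable (typedTriLoopCollection D δ) := by
  set S : Set (Site 2) := triMeshVertices D.carrier δ with hS
  haveI : Finite S := (triMeshVertices_finite_holds D.isBounded hδ).to_subtype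
  let r : SiteConfig (Site 2) → Set S := fun ω ↦ {x : S | (x : Site 2) ∈ ω}
  let g : Set S → Fin 2 → LoopSpace ℂ := fun A ↦ typedTriLoopCollection D δ (Subtype.val '' A)
  have hr : Measurable r := measurable_set_iff.2 fun x ↦ measurable_set_mem (x : Site 2)
  have hg : Measurable g := measurable_of_countable g
  have hfac : typedTriLoopCollection D δ = g ∘ r := by
    funext ω
    refine typedTriLoopCollection_eq_of_inter_eq ?_
    change ω ∩ S = Subtype.val '' {x : S | (x : Site 2) ∈ ω} ∩ S
    rw [image_val_setOf_mem_eq_inter, inter_assoc, inter_self]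
  rw [hfac]
  exact hg.comp hr

/-- Each typed collection is measurable in the configuration at fixed mesh `δ > 0`. [folklore] -/
theorem measurable_typedTriLoopCollection_apply (D : JordanDomain) {δ : ℝ} (hδ : 0 < δ)
    (i : Fin 2) : Measurable fun ω ↦ typedTriLoopCollection D δ ω i :=
  (measurable_pi_apply i).comp (measurable_typedTriLoopCollection D hδ)

/-! ### The typed configuration of a pair of loop collections -/

/-- **The typed configuration of unbased loops of a pair of loop collections**
`L : Fin 2 → LoopSpace ℂ`: `F i` is the set of unbased loops `UnbasedLoop.mk (BasedLoop.mk c _)`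
of the members `c` of `L i` that are loops (DKKMO's space `C`, arXiv:2012.11672v2, §1.2, for
a pair of Aizenman–Burchard / Camia–Newman closed sets of curves). [cite: arXiv201211672v2, §1.2] -/
def loopConfigOfLoopSpaces (L : Fin 2 → LoopSpace ℂ) : LoopConfig ℂ where
  F i := {u | ∃ (c : CurveClass ℂ) (hc : c.IsLoop), c ∈ L i ∧ u = UnbasedLoop.mk (BasedLoop.mk c hc)}

/-- Membership in `loopConfigOfLoopSpaces`, unfolded. [folklore] -/
theorem mem_loopConfigOfLoopSpaces_iff {L : Fin 2 → LoopSpace ℂ} {i : Fin 2} {u : UnbasedLoop ℂ} :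
    u ∈ (loopConfigOfLoopSpaces L).F i ↔
      ∃ (c : CurveClass ℂ) (hc : c.IsLoop), c ∈ L i ∧ u = UnbasedLoop.mk (BasedLoop.mk c hc) :=
  Iff.rfl

/-- The unbased loop of a loop member of `L i` belongs to `F i`. [folklore] -/
theorem mk_mem_loopConfigOfLoopSpaces {L : Fin 2 → LoopSpace ℂ} {i : Fin 2} {c : CurveClass ℂ}
    (hc : c ∈ L i) (hl : c.IsLoop) :
    UnbasedLoop.mk (BasedLoop.mk c hl) ∈ (loopConfigOfLoopSpaces L).F i :=
  ⟨c, hl, hc, rfl⟩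

/-- The typed full-plane configuration of the restricted configuration is contained, type by
type, in the typed configuration of its typed loop collections (the latter is closed under
limits of curve classes, the former lists the lattice loops themselves). [folklore] -/
theorem siteLoopConfig_subset_loopConfigOfLoopSpaces (D : JordanDomain) (δ : ℝ)
    (ω : SiteConfig (Site 2)) (i : Fin 2) :
    (siteLoopConfig δ (ω ∩ triMeshVertices D.carrier δ)).F i ⊆
      (loopConfigOfLoopSpaces (typedTriLoopCollection D δ ω)).F i := by
  rintro u ⟨f, γ, hγ, hi, rfl⟩
  exact mk_mem_loopConfigOfLoopSpaces (siteLoopCurve_mem_typedTriLoopCollection hγ hi) _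

/-! ### The bridge from Hausdorff closeness of typed collections to `d_CN ≤ ε` -/

/-- **DKKMO's `d` is dominated by the distance of curve classes**: for loops `c`, `c'`,
`d(⟦c⟧, ⟦c'⟧) ≤ dist c c'` (`d` is an infimum over more reparametrisations: all rotations of
the circle and the reversal; `UnbasedLoop.udist_le_dist`, `BasedLoop.dist_le_dist_toCurveClass`).
[cite: arXiv201211672v2, eq. (1)] -/
theorem udist_mk_mk_le_dist {c c' : CurveClass ℂ} (hc : c.IsLoop) (hc' : c'.IsLoop) :
    (UnbasedLoop.mk (BasedLoop.mk c hc)).udist (UnbasedLoop.mk (BasedLoop.mk c' hc')) ≤ dist c c' :=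
  (UnbasedLoop.udist_le_dist _ _).trans <| by
    rw [UnbasedLoop.dist_mk_mk]
    exact BasedLoop.dist_le_dist_toCurveClass _ _

/-- **The bridge.** If, for both types `i`, the typed loop collection of `ω` in `D` at mesh `δ`
is at Hausdorff extended distance `< η` from the collection `L i`, all of whose members are
loops, and `η ≤ ε`, then `d_CN(siteLoopConfig δ (ω ∩ triMeshVertices D δ), F_L) ≤ ε` in the
printed sense, where `F_L = loopConfigOfLoopSpaces L`: every lattice loop of type `i` has a
member of `L i` within `η` in the distance of curve classes, hence within `η` in `d`
(`udist_mk_mk_le_dist`), and conversely every member of `L i` has a *generator* of the typed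
collection within `η` (the closure is invisible to the Hausdorff distance,
`Metric.hausdorffEDist_closure_left`). No window is needed. [cite: arXiv201211672v2, §1.2] -/
theorem isClose_siteLoopConfig_of_hausdorffEDist_lt {D : JordanDomain} {δ ε η : ℝ} (hηε : η ≤ ε)
    {ω : SiteConfig (Site 2)} {L : Fin 2 → LoopSpace ℂ} (hL : ∀ i, ∀ c ∈ L i, c.IsLoop)
    (h : ∀ i, Metric.hausdorffEDist (typedTriLoopCollection D δ ω i : Set (CurveClass ℂ))
      (L i) < ENNReal.ofReal η) :
    LoopConfig.IsClose ε (siteLoopConfig δ (ω ∩ triMeshVertices D.carrier δ))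
      (loopConfigOfLoopSpaces L) := by
  intro i
  set G : Set (CurveClass ℂ) := {c | ∃ (f : HexVertex) (γ : hexGraph.Walk f f),
      IsSiteInterfaceLoop (ω ∩ triMeshVertices D.carrier δ) γ ∧
        (i = 1 ↔ 0 < shoelace (γ.support.map hexCenter)) ∧ c = siteLoopCurve δ γ} with hG
  have h' : Metric.hausdorffEDist G (L i : Set (CurveClass ℂ)) < ENNReal.ofReal η := by
    rw [← Metric.hausdorffEDist_closure_left]
    exact h i
  refine ⟨fun u hu _ ↦ ?_, fun u' hu' _ ↦ ?_⟩
  · obtain ⟨f, γ, hγ, hi, rfl⟩ := hu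
    have hmem : siteLoopCurve δ γ ∈ G := ⟨f, γ, hγ, hi, rfl⟩
    obtain ⟨c', hc', hd⟩ := Metric.exists_edist_lt_of_hausdorffEDist_lt hmem h'
    rw [edist_lt_ofReal] at hd
    refine ⟨_, mk_mem_loopConfigOfLoopSpaces hc' (hL i c' hc'), ?_⟩
    exact ((udist_mk_mk_le_dist _ _).trans hd.le).trans hηε
  · obtain ⟨c', hc'l, hc', rfl⟩ := hu'
    rw [Metric.hausdorffEDist_comm] at h'
    obtain ⟨c, hcG, hd⟩ := Metric.exists_edist_lt_of_hausdorffEDist_lt hc' h'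
    obtain ⟨f, γ, hγ, hi, rfl⟩ := hcG
    rw [edist_lt_ofReal] at hd
    exact ⟨_, ⟨f, γ, hγ, hi, rfl⟩, ((udist_mk_mk_le_dist _ _).trans hd.le).trans hηε⟩

/-- The bridge with the extended distance of `LoopSpace ℂ` (which is the Hausdorff extended
distance of the underlying closed sets, `TopologicalSpace.Closeds.edist_eq`). [cite: arXiv201211672v2, §1.2] -/
theorem isClose_siteLoopConfig_of_edist_lt {D : JordanDomain} {δ ε η : ℝ} (hηε : η ≤ ε)
    {ω : SiteConfig (Site 2)} {L : Fin 2 → LoopSpace ℂ} (hL : ∀ i, ∀ c ∈ L i, c.IsLoop)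
    (h : ∀ i, edist (typedTriLoopCollection D δ ω i) (L i) < ENNReal.ofReal η) :
    LoopConfig.IsClose ε (siteLoopConfig δ (ω ∩ triMeshVertices D.carrier δ))
      (loopConfigOfLoopSpaces L) :=
  isClose_siteLoopConfig_of_hausdorffEDist_lt hηε hL fun i ↦ by
    rw [← TopologicalSpace.Closeds.edist_eq]
    exact h i

/-- **The bridge for the whole-plane configuration** (with the locality of `d_CN ≤ ε`,
`isClose_siteLoopConfig_inter_iff`, Camia–Newman 2006 §6, proof of Thm 6): for `0 ≤ δ`,
`0 ≤ ε`, `η ≤ ε` and a Jordan domain `D ⊇ B(0, 1/ε + ε + δ)`, if both typed collections of `ω`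
in `D` are at extended distance `< η` from loop collections `L 0`, `L 1` of loops, then
`d_CN(siteLoopConfig δ ω, F_L) ≤ ε`. [cite: CamiaNewman2006, §6 (proof of Thm 6)] -/
theorem isClose_siteLoopConfig_of_edist_lt_of_ball_subset {D : JordanDomain} {δ ε η : ℝ}
    (hδ : 0 ≤ δ) (hε : 0 ≤ ε) (hηε : η ≤ ε) (hD : ball (0 : ℂ) (1 / ε + ε + δ) ⊆ D.carrier)
    {ω : SiteConfig (Site 2)} {L : Fin 2 → LoopSpace ℂ} (hL : ∀ i, ∀ c ∈ L i, c.IsLoop)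
    (h : ∀ i, edist (typedTriLoopCollection D δ ω i) (L i) < ENNReal.ofReal η) :
    LoopConfig.IsClose ε (siteLoopConfig δ ω) (loopConfigOfLoopSpaces L) :=
  (isClose_siteLoopConfig_inter_iff hδ hε hD ω _).1 (isClose_siteLoopConfig_of_edist_lt hηε hL h)

end Literature.Probability.Percolation

end
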